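import Summits.AtomisticToContinuum.Crystallization.Theorems.ChartedZeroExcessLayeredLatticeLiouvilleM

/-!
# ChartedZeroExcessLayered · LatticeLiouville — part N: §G «MinimisingDoor», THE ENERGY LEVER — A∞_G ⟸ X «ExcessFlatnessControl» by the tree's
comparison bound `BindingSurface` (PROVED); the X-columns (decomp-a2c lens-2 generation 27; NEW content, imports part M)

THE SPECIAL-CLASS MECHANISM MADE EXPLICIT.  On MINIMISERS the IDEA-NEEDED residual of g26, A∞ «ScaleExtinction» (blow-down flatness: the nonlinear
Liouville theorem at FINITE strain amplitude), is NOT a Liouville statement at all.  A minimiser carries an a-priori ENERGY BOUND by comparison: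
the tree's `BindingSurface` — «window excess `∑_{x ∈ window R} (e_x − e⋆) ≤ C₁ R²` for every rooted δ-hard-core e⋆-GSC configuration» — IS the
cut-and-paste bound (GSC with the empty competitor `k = 0`), PROVED (`ChartedPlanarOrderBindingSurface.bindingSurface_holds`, p816066) and so far
consumed only by K3.  If ENERGY CONTROLS FLATNESS — piece X below: the mean-square layered misfit of a root window is `≤ C·(excess⁺/R³ + 1/R)`,
a GÅRDING inequality for the site-energy excess at finite amplitude on the clean tube (plus the `L²`-rigidity that turns individually flat
environments into ONE chart, plus the surface bookkeeping `1/R`) — then on GSC door sets the misfit of the window of radius `R` is `≤ C(C₁+2)/R → 0`: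
EVENTUALLY LAYER-FLAT, i.e. A∞_G, with NO blow-down, NO compactness, NO linearisation:
  ★ `scaleExtinctionPG_of_excessControl : ExcessFlatnessControlP aHi Λ θ κ → ScaleExtinctionPG aHi Λ θ κ`   (PROVED here, every ceiling `aHi`).
Critical points (the Nash door) have no such bound: a non-minimising equilibrium may carry excess-energy DENSITY (volume-order excess), and then X says
nothing — this is exactly where the generic class escapes and why A∞ (Nash door) stays IDEA-NEEDED while A∞_G (GSC door) becomes X [ANALYTIC ·
CERT-backed · L].

* **X(aHi; Λ, θ, κ) «ExcessFlatnessControlP»** — ENERGY CONTROLS FLATNESS (GSC-FREE; a statement about the energy landscape and the rigidity of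
  clean charted configurations; the Nash clause of the door is carried but not needed): for every δ there are `C ≥ 0`, `R₀ ≥ 1` such that on every
  θ-good κ-flat `aHi`-door set, for `R ≥ R₀` and every `ε > 0`: `excess⁺(window R) ≤ ε·R³ ⇒` the window is `C·(ε + 1/R)`-flat in mean square
  (layered chart of distortion `≤ Λ`, environment radius 4) — equivalently `c·∑_{window} τ² ≤ excess⁺ + C·R²`.  Its three ingredients, each strictly
  smaller than a Liouville theorem: (x1) GÅRDING AT FINITE AMPLITUDE on the clean tube — the site-energy excess over e⋆ of a clean charted
  configuration dominates `c·`(squared misfit of the environment to its best layered pattern), up to tails: homogeneous phonon stability of every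
  Barlow stacking at every clean scale/strain (census TAG 164 C_lay SUPPORTED; TAG 174 (a) measures the strained-tube boundary) AND no spurious
  low-energy distortion inside the tube [CERT · interval arithmetic on a compact finite-dimensional family]; NOTE `e⋆ ≤ e(any periodic Barlow
  stacking)` BY DEFINITION of `e⋆ = ⨅ energyPerParticle`, so X never needs to know WHICH structure attains e⋆ (no crystal-problem import);
  (x2) `L²`-RIGIDITY — individually flat environments on a κ-coherent window are coherently flat under ONE layered chart at comparable mean square
  (Friesecke–James–Müller-type rigidity, discrete; the κ-flat chart of the hypothesis supplies the registration) [KNOWN-type technique · L];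
  (x3) the cluster bound `E(finite patch) ≥ n·e⋆` (subadditivity of minimal cluster energies + periodic approximation: `e⋆` = thermodynamic limit)
  and LJ cross-interaction tails `O(R²)` [FACT/TRUE · M].  Why it might fail: (x1) at the EDGE of the clean tube (two-shell distortion ≈ 1/16,
  scale ≈ 9/10) a distorted environment with excess below `c·τ²` — a finite computation decides; the constant, not the shape, is at risk.
  [UNDECIDED · TRUE-type · ANALYTIC·L + CERT · INSTRUMENTABLE: census TAG «GÅRDING» = on the K163B / TAG 171 relaxed clean states and on homogeneous
  tube samples, the ratio (window excess⁺ + C R²) / ∑ τ² bounded below.]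
* COLUMNS (A∞_G DISCHARGED modulo X):  `_16XG` : L → L_lay → R_G(2,1/16,1/16) → X(1;2,1/16,1/16) → K_G(2,1/16) → H_pert,G(2,1/16) → HBG″ →
  VisibleGap (1/50) ∧ PertRegime (1/50)  (SEVEN leaves; X replaces A∞_G leaf for leaf);  `_16XBG` (with H♭_G);  `_16XWG` at the W-ceiling.
* NOT TYPED (recorded for g28 / the critic): the same lever beneath K_G — EXCISION: K_G ⟸ (x1′) POINTWISE Gårding (a τ₀-misfitted environment costs
  `≥ c(τ₀)` excess in its 4-ball) ∧ (k1) GSC EXCISION LEMMA (in an e⋆-GSC door set the excess of a ball is `≤ C·`(mean-square misfit of the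
  surrounding annulus under the window chart)`·#annulus + tails`: GSC at EQUAL particle number against the chart patch glued in) — a core of misfit
  `τ₀` inside an η-flat window of radius `M·R` then forces `c(τ₀) ≤ C·η·#annulus`, impossible for `η ≤ κ₁(τ₀)` small: the «no cores in
  minimisers» argument; typing needs a ball/annulus excess vocabulary relative to a chart (definition request D-g27-1).
DEF-light (one `def … : Prop`), no sorry, axioms standard.
-/

noncomputable section

open scoped BigOperators InnerProductSpace RealInnerProductSpace
open MeasureTheory Set Metric Filter Topology
open Summit.AtomisticToContinuum.Crystallization.Theorems.ChartedPlanarOrderRigidityDoor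
  (E3 IsClean IsNash IsCharted IsEStarGSC VisibleGap PertRegime atomsIn siteEnergy eStar BindingSurface)
open Summit.AtomisticToContinuum.Crystallization.Theorems.ChartedPlanarOrderDensityDichotomy (μS IsSep nK nK_nonneg excess)
open Summit.AtomisticToContinuum.Crystallization.Theorems.ChartedPlanarOrderMesoCut (IsDoorSet NearHom LayeredHom EnvClose)
open Summit.AtomisticToContinuum.Crystallization.Theorems.OverbindingBudgetLiouvilleDictionary (NearHomBD)
open Summit.AtomisticToContinuum.Crystallization.Theorems.ChartedPlanarOrderDoorLayered
  (TwoPeriodic DoorPeriodic PeriodicBulkGapDoor gap_and_pert_1_50_of_periodic NearHomL2BD nearHomL2BD_mono nearHomBD_of_nearHomL2BD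
   sq_le_finsum_mem not_nearHomL2BD_singleton envClose_mono)
open Summit.AtomisticToContinuum.Crystallization.Theorems.ChartedPlanarOrderDoorLayeredOsc (IsTwoShellAffineGood DoorPeriodicOsc)
open Summit.AtomisticToContinuum.Crystallization.Theorems.ChartedPlanarOrderCleanScaleP
  (IsCleanP IsDoorSetP DoorPeriodicP isDoorSetP_mono doorPeriodic_of_doorPeriodicP isDoorSetP_one_iff doorPeriodicP_one_iff)

namespace Summit.AtomisticToContinuum.Crystallization.Theorems.ChartedZeroExcessLayeredLatticeLiouville

/-! ## §G.7  X «ExcessFlatnessControl» — energy controls flatness -/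

/-- **X(aHi; Λ, θ, κ) «ExcessFlatnessControlP»** — ENERGY CONTROLS FLATNESS: for every δ there are `C ≥ 0` and `R₀ ≥ 1` such that on every θ-good
κ-flat `aHi`-door set `S`, for every `R ≥ R₀` and `ε > 0`, if the positive part of the window excess `excess S (window R) = ∑ (e_x − e⋆)` is
`≤ ε·R³` then the window is `C·(ε + 1/R)`-flat in mean square under a layered chart of distortion `≤ Λ` (environment radius 4) — i.e.
`c·∑_{window} τ² ≤ excess⁺ + C·R²`: a GÅRDING inequality for the site-energy excess at FINITE amplitude on the clean tube (+ `L²`-rigidity to one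
chart + surface bookkeeping).  GSC-FREE.  With the tree's comparison bound `BindingSurface` (excess `≤ C₁R²` on e⋆-GSC configurations, PROVED) it
gives A∞_G (`scaleExtinctionPG_of_excessControl`, PROVED): on MINIMISERS blow-down flatness is an energy statement.  UNDECIDED · TRUE-type
(`e⋆ ≤` the energy per particle of every periodic Barlow stacking BY DEFINITION, so no crystal-problem import; perfect strained/restacked crystals have
misfit 0) · ANALYTIC·L + CERT (homogeneous tube stability, TAG 164 / TAG 174 (a)) · INSTRUMENTABLE (TAG «GÅRDING»).  Why it might fail: the Gårding
constant at the edge of the clean tube (distortion ≈ 1/16, scale ≈ 9/10) — a finite computation. [this file, g27] -/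
def ExcessFlatnessControlP (aHi Λ θ κ : ℝ) : Prop :=
  ∀ δ : ℝ, 0 < δ → ∃ C : ℝ, 0 ≤ C ∧ ∃ R₀ : ℝ, 1 ≤ R₀ ∧
    ∀ S : Set E3, IsDoorSetP aHi δ S → (∀ q ∈ S, IsTwoShellAffineGood θ S q) →
      (∀ R : ℝ, 0 < R → NearHomL2BD Λ κ 4 S (atomsIn (μS S) 0 R)) →
        ∀ R : ℝ, R₀ ≤ R → ∀ ε : ℝ, 0 < ε → max (excess S (atomsIn (μS S) 0 R)) 0 ≤ ε * R ^ 3 →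
          NearHomL2BD Λ (C * (ε + 1 / R)) 4 S (atomsIn (μS S) 0 R)

/-- X is ANTITONE in the ceiling. -/
theorem ExcessFlatnessControlP.anti {aHi aHi' Λ θ κ : ℝ} (hle : aHi ≤ aHi') (h : ExcessFlatnessControlP aHi' Λ θ κ) :
    ExcessFlatnessControlP aHi Λ θ κ := by
  intro δ hδ
  obtain ⟨C, hC, R₀, hR₀, h'⟩ := h δ hδ
  exact ⟨C, hC, R₀, hR₀, fun S hS => h' S (isDoorSetP_mono hle hS)⟩

/-- X is ANTITONE in θ and κ (more door sets qualify = a stronger statement). -/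
theorem ExcessFlatnessControlP.anti_anti {aHi Λ θ θ' κ κ' : ℝ} (hθ : θ ≤ θ') (hκ : κ ≤ κ') (h : ExcessFlatnessControlP aHi Λ θ' κ') :
    ExcessFlatnessControlP aHi Λ θ κ := by
  intro δ hδ
  obtain ⟨C, hC, R₀, hR₀, h'⟩ := h δ hδ
  exact ⟨C, hC, R₀, hR₀, fun S hS hO hflat => h' S hS (fun q hq => (hO q hq).mono hθ) (fun R hR => nearHomL2BD_mono hκ (hflat R hR))⟩

/-- **the comparison bound in door-set vocabulary**: on an e⋆-GSC door set the window excess is `≤ C₁ R²` (`R ≥ 1`) — the tree's `BindingSurface`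
(`bindingSurface_holds`) read through `excess S K = ∑ᶠ x ∈ K, (siteEnergy (μS S) x − eStar)` and `isRootedHardCore_μS`. -/
theorem excess_window_le_of_gsc {δ : ℝ} (hδ : 0 < δ) :
    ∃ C₁ : ℝ, 0 ≤ C₁ ∧ ∀ aHi : ℝ, ∀ S : Set E3, IsDoorSetPG aHi δ S → ∀ R : ℝ, 1 ≤ R → excess S (atomsIn (μS S) 0 R) ≤ C₁ * R ^ 2 := by
  obtain ⟨C₁, hC₁, hB⟩ := ChartedPlanarOrderBindingSurface.bindingSurface_holds δ hδ
  exact ⟨C₁, hC₁, fun aHi S hS R hR => hB (μS S) hS.isRootedHardCore hS.gsc R hR⟩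

/-- ★★ **A∞_G ⟸ X (PROVED)** — on MINIMISERS blow-down flatness is an ENERGY statement: `BindingSurface` bounds the window excess by `C₁R² ≤
((C₁+1)/R)·R³`, X turns it into mean-square flatness `C·((C₁+1)/R + 1/R) = C(C₁+2)/R`, which is `≤ ε` beyond `R₁ = max R₀ (C(C₁+2)/ε)`. -/
theorem scaleExtinctionPG_of_excessControl {aHi Λ θ κ : ℝ} (hX : ExcessFlatnessControlP aHi Λ θ κ) : ScaleExtinctionPG aHi Λ θ κ := by
  intro _hP _hL δ hδ S hS hO hflat ε hε
  obtain ⟨C, hC, R₀, hR₀, hX'⟩ := hX δ hδ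
  obtain ⟨C₁, hC₁, hB⟩ := excess_window_le_of_gsc hδ
  refine ⟨max R₀ (C * (C₁ + 2) / ε), fun R hR => ?_⟩
  have hR₀R : R₀ ≤ R := (le_max_left _ _).trans hR
  have hR1 : 1 ≤ R := hR₀.trans hR₀R
  have hRpos : 0 < R := one_pos.trans_le hR1
  have hexc : excess S (atomsIn (μS S) 0 R) ≤ C₁ * R ^ 2 := hB aHi S hS R hR1
  -- the positive part of the excess is `≤ ((C₁+1)/R)·R³`
  have hε' : 0 < (C₁ + 1) / R := by positivity
  have hmax : max (excess S (atomsIn (μS S) 0 R)) 0 ≤ (C₁ + 1) / R * R ^ 3 := by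
    have h1 : (C₁ + 1) / R * R ^ 3 = (C₁ + 1) * R ^ 2 := by
      field_simp
    rw [h1]
    refine max_le ?_ (by positivity)
    have h2 : C₁ * R ^ 2 ≤ (C₁ + 1) * R ^ 2 := by nlinarith [sq_nonneg R]
    exact hexc.trans h2
  have hwin := hX' S hS.1 hO hflat R hR₀R ((C₁ + 1) / R) hε' hmax
  refine nearHomL2BD_mono ?_ hwin
  -- `C·((C₁+1)/R + 1/R) = C(C₁+2)/R ≤ ε` since `R ≥ C(C₁+2)/ε`
  have h3 : C * ((C₁ + 1) / R + 1 / R) = C * (C₁ + 2) / R := by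
    rw [← add_div, mul_div_assoc]
    norm_num [add_assoc]
  rw [h3, div_le_iff₀ hRpos]
  have h4 : C * (C₁ + 2) / ε ≤ R := (le_max_right _ _).trans hR
  rw [div_le_iff₀ hε] at h4
  linarith [h4]

/-- hence **E_G ⟸ X ∧ H♭_G** and **P♭_G ⟸ X ∧ H♭_G** (`Λ ≤ 4`). -/
theorem linearisedFlatnessLayeredPG_of_excess_basin {aHi Λ θ κ : ℝ} (hΛ : Λ ≤ 4) (hX : ExcessFlatnessControlP aHi Λ θ κ)
    (hH : HalvingBasinPG aHi Λ θ) : LinearisedFlatnessLayeredPG aHi Λ θ κ :=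
  linearisedFlatnessLayeredPG_of_scale_basin hΛ (scaleExtinctionPG_of_excessControl hX) hH

/-! ## §G.8  The X-columns (A∞_G discharged modulo X) -/

/-- ★★ **COLUMN `_16XBG` — SIX leaves**: `LatticeLiouvilleCert → LayeredLiouvilleCert → R_G(2,1/16,1/16) → X(1; 2,1/16,1/16) → H♭_G(2,1/16) → HBG″ →
VisibleGap (1/50) ∧ PertRegime (1/50)`. -/
theorem gap_and_pert_1_50_of_certs_16XBG (hL : LatticeLiouvilleCert) (hL' : LayeredLiouvilleCert) (hR : OscRigidityL2BDPG 1 2 (1 / 16) (1 / 16))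
    (hX : ExcessFlatnessControlP 1 2 (1 / 16) (1 / 16)) (hB : HalvingBasinPG 1 2 (1 / 16)) (hG : PeriodicBulkGapDoor 2) :
    VisibleGap (1 / 50) ∧ PertRegime (1 / 50) :=
  gap_and_pert_1_50_of_certs_16BG hL hL' hR (scaleExtinctionPG_of_excessControl hX) hB hG

/-- ★★★ **COLUMN `_16XG` — SEVEN leaves, THE COLUMN OF THIS NODE**: `LatticeLiouvilleCert → LayeredLiouvilleCert → R_G(2,1/16,1/16) →
X(1; 2,1/16,1/16) → K_G(2,1/16) → H_pert,G(2,1/16) → HBG″ → VisibleGap (1/50) ∧ PertRegime (1/50)` — no Liouville-at-finite-amplitude leaf remains: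
the two linear certificates, the rigidity inequality, the Gårding inequality X, no-cores-in-minimisers K_G, the perturbative step H_pert,G, HBG″. -/
theorem gap_and_pert_1_50_of_certs_16XG (hL : LatticeLiouvilleCert) (hL' : LayeredLiouvilleCert) (hR : OscRigidityL2BDPG 1 2 (1 / 16) (1 / 16))
    (hX : ExcessFlatnessControlP 1 2 (1 / 16) (1 / 16)) (hK : CoreExclusionPG 1 2 (1 / 16)) (hPd : PerturbativeDecayPG 1 2 (1 / 16))
    (hG : PeriodicBulkGapDoor 2) : VisibleGap (1 / 50) ∧ PertRegime (1 / 50) :=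
  gap_and_pert_1_50_of_certs_16KG hL hL' hR (scaleExtinctionPG_of_excessControl hX) hK hPd hG

/-- ★★ **COLUMN `_16XG`, resolved form — ELEVEN leaves (the audit column)**: `LJDecay → LJMoments → CleanCrystalStability → LayeredDecay →
LayeredMoments → LayeredCrystalStability → R_G → X → K_G → H_pert,G → HBG″ → VisibleGap (1/50) ∧ PertRegime (1/50)`. -/
theorem gap_and_pert_1_50_of_layered_pieces_16XG (hD : LJDecay) (hM : LJMoments) (hC : CleanCrystalStability)
    (hD' : LayeredDecay) (hM' : LayeredMoments) (hC' : LayeredCrystalStability)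
    (hR : OscRigidityL2BDPG 1 2 (1 / 16) (1 / 16)) (hX : ExcessFlatnessControlP 1 2 (1 / 16) (1 / 16)) (hK : CoreExclusionPG 1 2 (1 / 16))
    (hPd : PerturbativeDecayPG 1 2 (1 / 16)) (hG : PeriodicBulkGapDoor 2) : VisibleGap (1 / 50) ∧ PertRegime (1 / 50) :=
  gap_and_pert_1_50_of_certs_16XG (latticeLiouvilleCert_of (latticeLinLiouville_of hD hM) hC) (layeredLiouvilleCert_of_pieces hD' hM' hC')
    hR hX hK hPd hG

/-- ★★ **THE `_16XWG` COLUMN, door half** (W-ceiling `103/100`): `LatticeLiouvilleCert → LayeredLiouvilleCert → R_G,W → X_W(103/100; 2,103/1600,1/16) →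
K_G,W → H_pert,G,W → DoorPeriodicPG 2 (103/100)`. -/
theorem doorPeriodicPGW_of_certs_16XWG (hL : LatticeLiouvilleCert) (hL' : LayeredLiouvilleCert)
    (hR : OscRigidityL2BDPG (103 / 100) 2 (103 / 1600) (1 / 16)) (hX : ExcessFlatnessControlP (103 / 100) 2 (103 / 1600) (1 / 16))
    (hK : CoreExclusionPG (103 / 100) 2 (103 / 1600)) (hPd : PerturbativeDecayPG (103 / 100) 2 (103 / 1600)) : DoorPeriodicPG 2 (103 / 100) :=
  doorPeriodicPGW_of_certs_16KWG hL hL' hR (scaleExtinctionPG_of_excessControl hX) hK hPd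

/-- ★★ **THE `_16XWG` COLUMN to N's conclusions — SEVEN leaves.** -/
theorem gap_and_pert_1_50_of_certs_16XWG (hL : LatticeLiouvilleCert) (hL' : LayeredLiouvilleCert)
    (hR : OscRigidityL2BDPG (103 / 100) 2 (103 / 1600) (1 / 16)) (hX : ExcessFlatnessControlP (103 / 100) 2 (103 / 1600) (1 / 16))
    (hK : CoreExclusionPG (103 / 100) 2 (103 / 1600)) (hPd : PerturbativeDecayPG (103 / 100) 2 (103 / 1600)) (hG : PeriodicBulkGapDoor 2) :
    VisibleGap (1 / 50) ∧ PertRegime (1 / 50) :=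
  gap_and_pert_1_50_of_periodicG ((doorPeriodicPGW_of_certs_16XWG hL hL' hR hX hK hPd).anti (by norm_num)) hG

/-- the W-leaf X_W gives the `aHi = 1` leaf X(1; 2, 1/16, 1/16) (ceiling `1 ≤ 103/100`, then `θ = 1/16 ≤ 103/1600`): `_16XWG` is leafwise STRONGER. -/
theorem excessFlatnessControl_of_W (hX : ExcessFlatnessControlP (103 / 100) 2 (103 / 1600) (1 / 16)) :
    ExcessFlatnessControlP 1 2 (1 / 16) (1 / 16) :=
  (hX.anti (by norm_num)).anti_anti (by norm_num) le_rfl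

end Summit.AtomisticToContinuum.Crystallization.Theorems.ChartedZeroExcessLayeredLatticeLiouville

end
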